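import Literature.NumberTheory.Automorphic.UnitOrbitalIntegralSplitTorusNonsplit
import Literature.NumberTheory.Automorphic.UnitaryGroupRegularTwistModulus
import Literature.NumberTheory.Automorphic.AnisotropicUnitaryGroupCompactOfPlace
import Literature.NumberTheory.Automorphic.LocalGLCongruenceBoxIwahori
import Literature.NumberTheory.Automorphic.LocalRegularOrbitClosed
import Literature.NumberTheory.Automorphic.UnitaryGroupQuasiSplitCMDatum
import Literature.NumberTheory.Rogawski1990.FinExplicitTransferFactorInertPlaceValuation
import Literature.NumberTheory.Rogawski1990.FinExplicitTransferFactorKappaEigenvector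
import Literature.NumberTheory.Rogawski1990.StableClassesSplitTorus
import HarnessLib

/-!
# Rogawski's explicit transfer factor on the LEVI (split-torus) stratum at an unramified non-split place: `Δ‴_v(γ_H, γ₀) = ‖d₀⁻¹d₁ − 1‖`
(`τ_v = 1`, `D_{G∕H,v} = ‖a − 1‖`, `κ_v = +1`; Rogawski (1990) §4.9 p. 55, Prop. 4.9.1 (b), (4.9.2) the Levi case; §4.3 p. 43; §14.6 p. 242; §3.5 Prop. 3.5.2 (c))

Topics `NumberTheory/Automorphic` (§0–§1, namespace `Literature.NumberTheory.Automorphic.UnitaryGroup`) and `NumberTheory/Rogawski1990` (§2–§4, namespace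
`Literature.NumberTheory.Rogawski1990`).  KERNEL mathematics only: theorems, no definition, no named fact, no instance, no notation, no `sorry`.  Cell
`pub/hodgecm-mathlib`, programme P3a, road «D-N7-inert» (map v2 f057cb56 §1 row L8 (P2)), brick «JUNCTION-Levi» FILE D = the TRANSFER FACTOR on the stratum (LEAD
F0P3a-plan (g9) T8-20 (D)(1); cut-holder F0P3b-p01 (g6)).  HONEST LABEL: HC_CM is proved only modulo the 2 remaining named inputs (hLiu418, h413) until rung 0 closes.

THE MATHEMATICS.  `v` a finite place of `L⁺` NON-SPLIT (`c • w = w`) and unramified in `L`, `H′` hermitian of good reduction at `w`, `μ` unramified at `w` with the N7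
μ-guard `μ|_{𝕀_{L⁺}} = ω_{L∕L⁺}`; `γ_H ∈ H_v` on the Levi stratum: `ι_v(γ_H) = diag(d₀, d₁, d₂) ∈ T(𝒪_v) ≤ U(Φ₃)(L⁺_v)` REGULAR (`dᵢ − dⱼ` units; `a = d₀⁻¹d₁`,
`b = d₀⁻¹d₂`; `u = d₁`, `g = diag(d₀, d₂)`).
* §0 `exists_continuousMulEquiv_level_formCongr_of_nonsplit`: Jacobowitz's `H′_w = ᵗσT·Φ₃·T`, `T ∈ GL₃(𝒪_w)`, packaged WITH the form identity (`ψ : U(H′)_v ≃ₜ* U(Φ₃)_v`,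
  `(ψ g)_w = T g_w T⁻¹`, `ψ(K′) = K₃`, `ψ g ∼ g` in `GL₃`).
* §1 bookkeeping from `ι_v(γ_H) = diag(d)`: `u = d₁`, `g = diag(d₀, d₂)`, `χ_g(u) = (d₁ − d₀)(d₁ − d₂)` (Mathlib `Matrix.charpoly_diagonal`); on `T(𝒪_v)`: `v_w(dᵢ) = 1`,
  `‖d₀‖ = 1`, `log v_w χ_g(u)_w = 2 · log v_w(a − 1)_w` (★ `HeisRing.weylNumerator_eq`, `v_w ∘ σ_w = v_w`).
* §2 ONE CLASS: all `γ₀ ∈ U(H′)_v` matching `γ_H` are conjugate IN `U(H′)_v` (`𝔇(T_G) = 1`; ★ `isConj_of_isStablyConj_of_splitFrame_three`, frame from a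
  `GL₃`-conjugator, unit conditions from regularity via the torus relations) — the `huniqG` binder of the letter clause on the stratum.
* §3 `κ_v(γ_H, γ₀) = +1`: for `γ₁ := ψ⁻¹(ι_v γ_H)` the `u`-eigenvector `p′ = T⁻¹e₂` has `H′(p′,p′) = (ᵗσ(T⁻¹)·H′_w·T⁻¹)₂₂ = (Φ₃)₂₂ = 1`, a norm (★
  `finKappaAt_eq_one_of_eigenvector_of_exists`); `κ_v` is a class function (★ `finKappaAt_conj_right`) and §2 moves it to every matching `γ₀`.
* §4 HEAD `finExplicitDelta_eq_unitModulusChar_of_levi_of_nonsplit`: `Δ‴_v = τ_v · D_v · κ_v` with `τ_v = (−1)^{2·log v_w(a−1)} = 1` (★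
  `finTau_eq_neg_one_zpow_of_nonsplit_of_isUnramifiedIn`), `D_v = √(∏_w ‖χ_g(u)_w‖) = ‖a − 1‖ · √‖d₀‖ = ‖a − 1‖` (★ `sqrt_prod_norm_weylNumerator_cmLocal`), `κ_v = 1`:
  **`Δ‴_v(γ_H, γ₀) = ‖d₀⁻¹d₁ − 1‖`** (`‖·‖ = unitModulusChar (∏_{w∣v} L_w)`).  Against ★ FILE C2's `Φ(⟦γ₀⟧, 1_{K′}) = (‖a − 1‖ · √‖b − 1‖)⁻¹` this leaves exactly
  the `H`-side module `(√‖b − 1‖)⁻¹`.  NOT here: the `H`-side value and the letter clause (sequel files of the junction).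

## References
* [Rogawski1990] J. D. Rogawski, *Automorphic Representations of Unitary Groups in Three Variables*, Ann. of Math. Stud. 123 (1990), §4.9 p. 55; §4.3 p. 43;
  §3.5 Prop. 3.5.2 (c) p. 29; §14.2 p. 233; §14.6 p. 242.
* [Jacobowitz1962] R. Jacobowitz, *Hermitian forms over local fields*, Amer. J. Math. 84 (1962), §7 Thm. 7.1.
* [TateThesis1967] J. Tate, *Fourier analysis in number fields and Hecke's zeta-functions*, §2.5.
* [LanglandsShelstad1987] R. P. Langlands, D. Shelstad, *On the definition of transfer factors*, Math. Ann. 278 (1987), §1–§2.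
-/

set_option autoImplicit false

noncomputable section

open NumberField IsDedekindDomain Matrix Polynomial
open scoped NNReal Matrix MatrixGroups

/-! ## §0 The comparison `ψ : U(H′)_v ≃ U(Φ₃)_v` with its form datum -/

namespace Literature.NumberTheory.Automorphic.UnitaryGroup

open Literature.NumberTheory.Automorphic

/-- `IsConj` descends along a multiplicative equivalence. [cite: Rogawski1990, §3.1 p. 19] -/
private theorem isConj_of_isConj_mulEquiv_aux {G G' : Type*} [Monoid G] [Monoid G'] (e : G ≃* G') {a b : G}
    (h : IsConj (e a) (e b)) : IsConj a b := by
  have h' := MonoidHom.map_isConj e.symm.toMonoidHom h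
  simpa using h'

/-- **THE LEVEL-PRESERVING COMPARISON `ψ : U(H′)(L⁺_v) ≃ U(Φ₃)(L⁺_v)` WITH ITS FORM DATUM** at a good non-split place: Jacobowitz's `T ∈ GL₃(𝒪_w)` with
`H′_w = ᵗσT · Φ₃ · T` (★ `exists_glInt_placeForm_eq_formCongr_antidiagonal_of_isUnramifiedIn`), `ψ =` ★ `localNonsplitCongr` (`(ψ g)_w = T g_w T⁻¹`): `ψ` preserves the
hyperspecial levels, `ψ g ∼ g` in `GL₃(∏_{w′∣v} L_{w′})`, and the form identity is exported. [cite: Rogawski1990, §14.2 p. 233] [cite: Jacobowitz1962, §7 Thm. 7.1] -/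
theorem exists_continuousMulEquiv_level_formCongr_of_nonsplit (L : Type) [Field L] [NumberField L] [IsCMField L]
    (H' : Matrix (Fin 3) (Fin 3) L) (hH' : (H'.map (IsCMField.complexConj L))ᵀ = H')
    {v : HeightOneSpectrum (𝓞 ↥(maximalRealSubfield L))} (w : PlacesOver L v) (hw : IsCMField.complexConj L • w.1 = w.1)
    (hv : Algebra.IsUnramifiedIn (𝓞 L) v.asIdeal) (hH'w : IsUnit (placeForm H' w.1)) (hH'i : hH'w.unit ∈ glInt 3 (w.1.adicCompletion L)) :
    ∃ ψ : (cmDatum L 3 H').Local v ≃ₜ* ↥(unitaryGroupOfForm (conjLocal L (IsCMField.complexConj L) v) (cmLocalForm L 3 v)),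
      ∃ T : GL (Fin 3) (w.1.adicCompletion L), T ∈ glInt 3 (w.1.adicCompletion L) ∧
      placeForm H' w.1 = formCongr (galAdicCompletionMap (L := L) (IsCMField.complexConj L) hw) T
        ((StdForm.antidiagonal 3).over (w.1.adicCompletion L)) ∧
      (∀ g, ψ g ∈ cmLocalIntegralLevel L 3 (Matrix.of fun i j : Fin 3 => if i.val + j.val + 1 = 3 then (1 : L) else 0) v ↔
          g ∈ cmLocalIntegralLevel L 3 H' v) ∧
      (∀ g, IsConj ((g.val : GL (Fin 3) (LocalRing L v)))
          (((ψ g : ↥(unitaryGroupOfForm (conjLocal L (IsCMField.complexConj L) v) (cmLocalForm L 3 v))) : GL (Fin 3) (LocalRing L v)))) ∧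
      ∀ g, localGLPiEquiv L 3 v
          (((ψ g : ↥(unitaryGroupOfForm (conjLocal L (IsCMField.complexConj L) v) (cmLocalForm L 3 v))) : GL (Fin 3) (LocalRing L v))) w =
        T * localGLPiEquiv L 3 v (g.val : GL (Fin 3) (LocalRing L v)) w * T⁻¹ := by
  have hc := IsCMField.complexConj_ne_one L
  haveI : Algebra.IsQuadraticExtension ↥(maximalRealSubfield L) L := IsCMField.isQuadraticExtension L
  obtain ⟨T, hT, hJT⟩ := exists_glInt_placeForm_eq_formCongr_antidiagonal_of_isUnramifiedIn ↥(maximalRealSubfield L) L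
    (IsCMField.complexConj L) hc 3 H' hH' v w hw hv hH'w hH'i
  have h : formCongr (galAdicCompletionMap (L := L) (IsCMField.complexConj L) hw) T
      (placeForm (Matrix.of fun i j : Fin 3 => if i.val + j.val + 1 = 3 then (1 : L) else 0) w.1) =
        (1 : w.1.adicCompletion L) • placeForm H' w.1 := by
    rw [one_smul, placeForm_antidiagOne, ← hJT]
  refine ⟨localNonsplitCongr (IsCMField.complexConj L) hc w hw T isUnit_one h, T, hT, hJT, fun g => ?_, fun g => ?_, fun g =>
    localNonsplitEquiv_localNonsplitCongr (IsCMField.complexConj L) hc w hw T isUnit_one h g⟩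
  · -- level preservation
    have e1 := mem_localIntegralLevel_iff_of_smul_eq (IsCMField.complexConj L) 3
      (Matrix.of fun i j : Fin 3 => if i.val + j.val + 1 = 3 then (1 : L) else 0) hc w hw
      (localNonsplitCongr (IsCMField.complexConj L) hc w hw T isUnit_one h g)
    have e2 := mem_localIntegralLevel_iff_of_smul_eq (IsCMField.complexConj L) 3 H' hc w hw g
    refine (e1.trans ?_).trans e2.symm
    rw [localNonsplitEquiv_localNonsplitCongr]
    constructor
    · intro h'
      have h'' := Subgroup.mul_mem _ (Subgroup.mul_mem _ (Subgroup.inv_mem _ hT) h') hT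
      simpa only [mul_assoc, mul_inv_cancel_left, inv_mul_cancel, mul_one, inv_mul_cancel_left] using h''
    · intro h'
      exact Subgroup.mul_mem _ (Subgroup.mul_mem _ hT h') (Subgroup.inv_mem _ hT)
  · -- conjugacy in `GL₃(∏ L_{w′})` from the one-component conjugacy
    refine isConj_of_isConj_mulEquiv_aux
      ((localGLPiEquiv L 3 v).toMulEquiv.trans (localGLPiEvalEquiv (IsCMField.complexConj L) 3 hc w hw).toMulEquiv) ?_
    show IsConj (localGLPiEquiv L 3 v (g.val : GL (Fin 3) (LocalRing L v)) w)
      (localGLPiEquiv L 3 v (((localNonsplitCongr (IsCMField.complexConj L) hc w hw T isUnit_one h g :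
          ↥(unitaryGroupOfForm (conjLocal L (IsCMField.complexConj L) v) (cmLocalForm L 3 v))) : GL (Fin 3) (LocalRing L v))) w)
    have e := localNonsplitEquiv_localNonsplitCongr (IsCMField.complexConj L) hc w hw T isUnit_one h g
    change localGLPiEquiv L 3 v _ w = T * localGLPiEquiv L 3 v _ w * T⁻¹ at e
    rw [e]
    exact isConj_iff.2 ⟨T, rfl⟩

/-! ## §1 Eigenvalue bookkeeping on the Levi stratum `ι_v(γ_H) = diag(d)` -/

section LeviStratum

open Literature.NumberTheory.Rogawski1990
open Literature.NumberTheory.GaloisRepresentations Literature.NumberTheory.GaloisRepresentations.IsNonarchimedeanLocalField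

variable (L : Type) [Field L] [NumberField L] [IsCMField L] (v : HeightOneSpectrum (𝓞 ↥(maximalRealSubfield L)))
  (γH : (cmDatum L 2 (Matrix.of fun i j : Fin 2 => if i.val + j.val + 1 = 2 then (1 : L) else 0)).Local v ×
    (cmDatum L 1 (Matrix.of fun i j : Fin 1 => if i.val + j.val + 1 = 1 then (1 : L) else 0)).Local v)
  {d : Fin 3 → (LocalRing L v)ˣ} (hι : ((endoEmbLocal L v γH).val : GL (Fin 3) (LocalRing L v)) = glDiagonal 3 (LocalRing L v) d)

include hι

/-- On the Levi stratum `ι_v(γ_H) = diag(d₀, d₁, d₂)` the `U(Φ₁)`-coordinate is `u = d₁`. [cite: Rogawski1990, §4.8 Case (a) p. 53; §4.9 p. 55] -/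
theorem finGammaTwo_eq_of_endoEmbLocal_eq : finGammaTwo L v γH = (d 1 : LocalRing L v) := by
  have h := congrArg (fun g : GL (Fin 3) (LocalRing L v) => (g : Matrix (Fin 3) (Fin 3) (LocalRing L v)) 1 1) hι
  simp only [coe_endoEmbLocal, coe_endoGL_eq, coe_glDiagonal, Matrix.diagonal_apply_eq, Matrix.of_apply, Matrix.cons_val',
    Matrix.cons_val_one, Matrix.cons_val_zero, Matrix.empty_val', Matrix.cons_val_fin_one] at h
  exact h

/-- On the Levi stratum the `U(Φ₂)`-part is `g = diag(d₀, d₂)`. [cite: Rogawski1990, §4.8 Case (a) p. 53; §4.9 p. 55] -/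
theorem coe_fst_eq_diagonal_of_endoEmbLocal_eq :
    (γH.1.val.val : Matrix (Fin 2) (Fin 2) (LocalRing L v)) = Matrix.diagonal ![(d 0 : LocalRing L v), (d 2 : LocalRing L v)] := by
  have h := fun i j : Fin 3 => congrArg (fun g : GL (Fin 3) (LocalRing L v) => (g : Matrix (Fin 3) (Fin 3) (LocalRing L v)) i j) hι
  simp only [coe_endoEmbLocal, coe_endoGL_eq, coe_glDiagonal] at h
  refine Matrix.ext fun i j => ?_
  fin_cases i <;> fin_cases j <;> [simpa using h 0 0; simpa using h 0 2; simpa using h 2 0; simpa using h 2 2]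

/-- **`χ_g(u) = (d₁ − d₀)(d₁ − d₂)`** on the Levi stratum (`g = diag(d₀, d₂)`, `u = d₁`; Mathlib `Matrix.charpoly_diagonal`) — B-p12's «Weyl numerator»
(★ `HeisRing.weylNumerator_eq`). [cite: Rogawski1990, §4.9 p. 55] -/
theorem eval_finCharpolyTwo_eq_of_endoEmbLocal_eq :
    (finCharpolyTwo L v γH).eval (finGammaTwo L v γH) =
      ((d 1 : LocalRing L v) - d 0) * ((d 1 : LocalRing L v) - d 2) := by
  unfold finCharpolyTwo
  rw [coe_fst_eq_diagonal_of_endoEmbLocal_eq L v γH hι, Matrix.charpoly_diagonal, finGammaTwo_eq_of_endoEmbLocal_eq L v γH hι,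
    Fin.prod_univ_two, eval_mul, eval_sub, eval_sub, eval_X, eval_C, eval_C]
  rfl

omit hι in
/-- **The Levi stratum in `H`-coordinates**: for `γ_H = (g, u)` with `g = diag(d′₀, d′₁)` diagonal, `ι_v(γ_H) = diag(d′₀, u, d′₁)` — the shape `hι` consumed
below, with `d = (d′₀, u, d′₁)`. [cite: Rogawski1990, §4.8 Case (a) p. 53; §4.9 p. 55] -/
theorem endoEmbLocal_eq_glDiagonal_of_fst_eq {d' : Fin 2 → (LocalRing L v)ˣ} (hd' : glDiagonal 2 (LocalRing L v) d' = (γH.1.val : GL (Fin 2) (LocalRing L v))) :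
    ((endoEmbLocal L v γH).val : GL (Fin 3) (LocalRing L v)) =
      glDiagonal 3 (LocalRing L v) ![d' 0, (isUnit_finGammaTwo L v γH).unit, d' 1] := by
  have h := fun i j => congrArg (fun g : GL (Fin 2) (LocalRing L v) => (g : Matrix (Fin 2) (Fin 2) (LocalRing L v)) i j) hd'
  simp only [coe_glDiagonal] at h
  refine Units.ext ?_
  rw [coe_endoEmbLocal, coe_endoGL_eq, coe_glDiagonal]
  refine Matrix.ext fun i j => ?_
  fin_cases i <;> fin_cases j <;> simp [← h, finGammaTwo]

/-- `ι_v(γ_H)` lies on the diagonal torus `T ≤ U(Φ₃)(L⁺_v)`. [cite: Rogawski1990, §1.10 p. 9; §4.9 p. 55] -/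
theorem endoEmbLocal_mem_torusU_of_endoEmbLocal_eq :
    (endoEmbLocal L v γH : ↥(unitaryGroupOfForm (conjLocal L (IsCMField.complexConj L) v) (cmLocalForm L 3 v))) ∈
      torusU (conjLocal L (IsCMField.complexConj L) v) (cmLocalForm L 3 v) :=
  ⟨d, hι.symm⟩

/-- **On `T(𝒪_v)` the diagonal entries are `w`-units**: `ι_v(γ_H) = diag(d) ∈ K₃ = U(Φ₃)(𝒪_v)` forces `v_{w}(dᵢ,w) = 1` at every `w ∣ v` (entries and inverse
entries integral, ★ `mem_localIntegralLevel_iff`, ★ `mem_glInt_iff_forall_v_le_one`). [cite: Rogawski1990, §4.9 p. 55] -/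
theorem valued_apply_eq_one_of_endoEmbLocal_mem
    (hint : endoEmbLocal L v γH ∈ cmLocalIntegralLevel L 3 (Matrix.of fun i j : Fin 3 => if i.val + j.val + 1 = 3 then (1 : L) else 0) v)
    (i : Fin 3) (w : PlacesOver L v) : Valued.v ((d i : LocalRing L v) w) = 1 := by
  have hm := (Literature.NumberTheory.Automorphic.mem_glInt_iff_forall_v_le_one _).1 ((mem_localIntegralLevel_iff (IsCMField.complexConj L) 3 _ v (endoEmbLocal L v γH)).1 hint w)
  have h1 : Valued.v ((d i : LocalRing L v) w) ≤ 1 := by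
    have h := hm.1 i i
    rw [localGLPiEquiv_apply_apply, hι, coe_glDiagonal, Matrix.diagonal_apply_eq] at h
    exact h
  have h2 : Valued.v ((((d i)⁻¹ : (LocalRing L v)ˣ) : LocalRing L v) w) ≤ 1 := by
    have h := hm.2 i i
    rw [← Pi.inv_apply, ← map_inv, localGLPiEquiv_apply_apply, hι, ← map_inv, coe_glDiagonal, Matrix.diagonal_apply_eq,
      Pi.inv_apply] at h
    exact h
  have hprod : Valued.v ((d i : LocalRing L v) w) * Valued.v ((((d i)⁻¹ : (LocalRing L v)ˣ) : LocalRing L v) w) = 1 := by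
    rw [← map_mul, ← Pi.mul_apply, Units.mul_inv, Pi.one_apply, map_one]
  refine le_antisymm h1 ?_
  calc (1 : WithZero (Multiplicative ℤ)) = Valued.v ((d i : LocalRing L v) w) * Valued.v ((((d i)⁻¹ : (LocalRing L v)ˣ) : LocalRing L v) w) := hprod.symm
    _ ≤ Valued.v ((d i : LocalRing L v) w) * 1 := mul_le_mul' le_rfl h2
    _ = Valued.v ((d i : LocalRing L v) w) := mul_one _

/-- **`‖d₀‖ = 1` on `T(𝒪_v)`** (`‖·‖ = unitModulusChar (∏_{w∣v} L_w) = ∏_w |·|_w`, ★ `unitModulusChar_localRing_eq_prod`). [cite: Rogawski1990, §4.9 p. 55] -/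
theorem unitModulusChar_eq_one_of_endoEmbLocal_mem
    (hint : endoEmbLocal L v γH ∈ cmLocalIntegralLevel L 3 (Matrix.of fun i j : Fin 3 => if i.val + j.val + 1 = 3 then (1 : L) else 0) v)
    (i : Fin 3) : unitModulusChar (LocalRing L v) (d i) = 1 := by
  rw [unitModulusChar_localRing_eq_prod]
  refine Finset.prod_eq_one fun w _ => ?_
  have h : Valued.v ((d i : LocalRing L v) w) = WithZero.exp 0 := by
    rw [WithZero.exp_zero]; exact valued_apply_eq_one_of_endoEmbLocal_mem L v γH hι hint i w
  rw [normAbs_eq_inv_zpow_of_valued_eq w.1 h, neg_zero, zpow_zero]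

/-- **`log v_w(χ_g(u)_w) = 2 · log v_w((a − 1)_w)` on `T(𝒪_v)`** (`a = d₀⁻¹d₁`): `χ_g(u) = (d₁ − d₀)(d₁ − d₂) = −d₀d₁(a − 1)σ(a − 1)` (★ `HeisRing.weylNumerator_eq`),
`v_w(d₀) = v_w(d₁) = 1`, `v_w ∘ σ_w = v_w` — so print's exponent `n₁₂ + n₂₃` is EVEN on the Levi stratum. [cite: Rogawski1990, §4.9 p. 55] -/
theorem log_valued_eval_finCharpolyTwo_eq_two_mul (w : PlacesOver L v) (hw : IsCMField.complexConj L • w.1 = w.1)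
    (hint : endoEmbLocal L v γH ∈ cmLocalIntegralLevel L 3 (Matrix.of fun i j : Fin 3 => if i.val + j.val + 1 = 3 then (1 : L) else 0) v)
    (ha : IsUnit ((((d 0)⁻¹ * d 1 : (LocalRing L v)ˣ) : LocalRing L v) - 1)) :
    WithZero.log (Valued.v (((finCharpolyTwo L v γH).eval (finGammaTwo L v γH)) w)) =
      2 * WithZero.log (Valued.v (((((d 0)⁻¹ * d 1 : (LocalRing L v)ˣ) : LocalRing L v) - 1) w)) := by
  have ht := endoEmbLocal_mem_torusU_of_endoEmbLocal_eq L v γH hι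
  rw [eval_finCharpolyTwo_eq_of_endoEmbLocal_eq L v γH hι,
    HeisRing.weylNumerator_eq (conjLocal L (IsCMField.complexConj L) v) (cmLocalForm_eq_over L 3 v) ⟨_, ht⟩ hι.symm]
  have hz : Valued.v (((((d 0)⁻¹ * d 1 : (LocalRing L v)ˣ) : LocalRing L v) - 1) w) ≠ 0 :=
    (Valuation.ne_zero_iff _).2 (Pi.isUnit_iff.1 ha w).ne_zero
  rw [Pi.neg_apply, Valuation.map_neg, Pi.mul_apply, Pi.mul_apply, Pi.mul_apply, map_mul, map_mul, map_mul,
    valued_apply_eq_one_of_endoEmbLocal_mem L v γH hι hint 0 w, valued_apply_eq_one_of_endoEmbLocal_mem L v γH hι hint 1 w, one_mul, one_mul,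
    conjLocal_apply_eq_galAdicCompletionMap L v w hw, valued_galAdicCompletionMap,
    WithZero.log_mul hz hz, two_mul]

end LeviStratum

end Literature.NumberTheory.Automorphic.UnitaryGroup

/-! ## §2 One class: every `γ₀ ∈ U(H′)(L⁺_v)` matching a Levi-stratum `γ_H` is conjugate to any other -/

namespace Literature.NumberTheory.Rogawski1990

open Literature.NumberTheory.Automorphic Literature.NumberTheory.Automorphic.UnitaryGroup
open Literature.NumberTheory.GaloisRepresentations Literature.NumberTheory.GaloisRepresentations.IsNonarchimedeanLocalField

/-- From a torus relation `σ(dᵢ)d_k = 1` and regularity `d_j − d_k ∈ R^×`: `σ(dᵢ)d_j − 1 = d_k⁻¹(d_j − d_k)` is a unit. [cite: Rogawski1990, §1.10 p. 9] -/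
private theorem isUnit_map_mul_sub_one_aux {R : Type*} [CommRing R] (σ : R →+* R) {d : Fin 3 → Rˣ} {i j k : Fin 3}
    (hik : σ (d i : R) * d k = 1) (hjk : IsUnit ((d j : R) - d k)) : IsUnit (σ (d i : R) * d j - 1) := by
  have hσ : σ (d i : R) = (((d k)⁻¹ : Rˣ) : R) := by
    rw [← mul_one (σ (d i : R)), ← Units.mul_inv (d k), ← mul_assoc, hik, one_mul]
  rw [hσ, show (((d k)⁻¹ : Rˣ) : R) * d j - 1 = (((d k)⁻¹ : Rˣ) : R) * ((d j : R) - d k) by rw [mul_sub, Units.inv_mul]]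
  exact (Units.isUnit _).mul hjk

/-- **ONE CLASS ON THE LEVI STRATUM (`𝔇(T_G) = 1`).**  At any finite place `v`, for `H′` hermitian with `det H′ ≠ 0` and `γ_H ∈ H_v` with `ι_v(γ_H) = diag(d)`
REGULAR (`dᵢ − dⱼ` units of `∏_{w∣v} L_w`), any two `γ₁, γ₀ ∈ U(H′)(L⁺_v)` matching `γ_H` (`GL₃`-conjugate to `ι_v(γ_H)`) are conjugate IN `U(H′)(L⁺_v)` — ★
`isConj_of_isStablyConj_of_splitFrame_three` with the frame read off a `GL₃`-conjugator `γ₁ = c·diag(d)·c⁻¹`, its six unit conditions `σ(dᵢ)dⱼ − 1 ∈ R^×` from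
regularity via the torus relations `σ(d₂)d₀ = σ(d₁)d₁ = σ(d₀)d₂ = 1` (★ `HeisRing.torus_relations`); the `huniqG` binder of ★
`finsum_delta_mul_classOrbitalIntegral_indicator_eq_of_unique` on the stratum (no integrality needed). [cite: Rogawski1990, §3.5 Prop. 3.5.2 p. 29; §4.9 p. 55] -/
theorem isConj_of_isLocalNormPair_of_isLocalNormPair_of_levi (L : Type) [Field L] [NumberField L] [IsCMField L]
    (H' : Matrix (Fin 3) (Fin 3) L) (hH' : (H'.map (IsCMField.complexConj L))ᵀ = H') (hH'd : IsUnit H'.det)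
    {v : HeightOneSpectrum (𝓞 ↥(maximalRealSubfield L))}
    (γH : (cmDatum L 2 (Matrix.of fun i j : Fin 2 => if i.val + j.val + 1 = 2 then (1 : L) else 0)).Local v ×
      (cmDatum L 1 (Matrix.of fun i j : Fin 1 => if i.val + j.val + 1 = 1 then (1 : L) else 0)).Local v)
    {d : Fin 3 → (UnitaryGroup.LocalRing L v)ˣ}
    (hι : ((endoEmbLocal L v γH).val : GL (Fin 3) (UnitaryGroup.LocalRing L v)) = glDiagonal 3 (UnitaryGroup.LocalRing L v) d)
    (hreg : ∀ i j, i ≠ j → IsUnit ((d i : UnitaryGroup.LocalRing L v) - d j)) {γ₁ γ₀ : (cmDatum L 3 H').Local v}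
    (h₁ : IsLocalNormPair L H' v γH γ₁) (h₀ : IsLocalNormPair L H' v γH γ₀) : IsConj γ₁ γ₀ := by
  have ht := endoEmbLocal_mem_torusU_of_endoEmbLocal_eq L v γH hι
  obtain ⟨h20, h11, h02⟩ := HeisRing.torus_relations (conjLocal L (IsCMField.complexConj L) v) (cmLocalForm_eq_over L 3 v) ⟨_, ht⟩ hι.symm
  have hst : IsStablyConj (conjLocal L (IsCMField.complexConj L) v) ((adelicForm L 3 H').map (adeleToLocal L v)) γ₁ γ₀ :=
    (IsConj.symm h₁).trans h₀
  -- the split frame of `γ₁` from a `GL₃`-conjugator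
  have h₁' : IsConj ((endoEmbLocal L v γH).val : GL (Fin 3) (UnitaryGroup.LocalRing L v)) γ₁.val := h₁
  obtain ⟨c, hc⟩ := isConj_iff.1 h₁'
  have hGL : γ₁.val * c = c * glDiagonal 3 (UnitaryGroup.LocalRing L v) d :=
    calc γ₁.val * c = c * (endoEmbLocal L v γH).val * c⁻¹ * c := by rw [hc]
      _ = c * (endoEmbLocal L v γH).val := inv_mul_cancel_right _ _
      _ = c * glDiagonal 3 (UnitaryGroup.LocalRing L v) d := by rw [hι]
  have hP : γ₁.val.val * c.val = c.val * Matrix.diagonal fun k => (d k : UnitaryGroup.LocalRing L v) := by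
    have h' := congrArg (fun g : GL (Fin 3) (UnitaryGroup.LocalRing L v) => g.val) hGL
    simpa only [Units.val_mul, coe_glDiagonal] using h'
  exact isConj_of_isStablyConj_of_splitFrame_three (conjLocal L (IsCMField.complexConj L) v) _ (conjLocal_conjLocal_cm L v)
    (map_conjLocal_transpose_localForm L 3 H' v hH') (isUnit_det_localForm L 3 H' v hH'd.ne_zero) hst c hP
    (isUnit_map_mul_sub_one_aux _ h02 (hreg 0 2 (by decide))) (isUnit_map_mul_sub_one_aux _ h02 (hreg 1 2 (by decide)))
    (isUnit_map_mul_sub_one_aux _ h11 (hreg 0 1 (by decide))) (isUnit_map_mul_sub_one_aux _ h11 (hreg 2 1 (by decide)))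
    (isUnit_map_mul_sub_one_aux _ h20 (hreg 1 0 (by decide))) (isUnit_map_mul_sub_one_aux _ h20 (hreg 2 0 (by decide)))

/-! ## §3 `κ_v(γ_H, γ₀) = +1` on the Levi stratum -/

/-- **THE ENDOSCOPIC SIGN IS `+1` ON THE LEVI STRATUM**: at a finite place `v` of `L⁺` non-split and unramified in `L`, for `H′` hermitian of good reduction at `w`
and `γ_H ∈ H_v` with `ι_v(γ_H) = diag(d)` regular, `κ_v(γ_H, γ₀) = 1` for EVERY `γ₀ ∈ U(H′)(L⁺_v)` matching `γ_H`: for `γ₁ := ψ⁻¹(ι_v γ_H)` (§0,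
`γ₁,w = T⁻¹ diag(d_w) T`, `H′_w = ᵗσT Φ₃ T`) the column `p′ = T⁻¹e₂` is a `u = d₁`-eigenvector with `H′(p′, p′) = (Φ₃)₂₂ = 1 = 1·σ(1)` (★
`finKappaAt_eq_one_of_eigenvector_of_exists`); `γ₀ = yγ₁y⁻¹` (§2) and `κ_v` is a class function (★ `finKappaAt_conj_right`).  Print: «`κ(γ, ψ_v(i(γ)))` is
equal to `±1` and it is `+1` for almost all `v`». [cite: Rogawski1990, §14.6 p. 242; §3.5 Prop. 3.5.2 (c) p. 29; §4.3 p. 43] [cite: LanglandsShelstad1987, §2] -/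
theorem finKappaAt_eq_one_of_levi_of_nonsplit (L : Type) [Field L] [NumberField L] [IsCMField L]
    (H' : Matrix (Fin 3) (Fin 3) L) (hH' : (H'.map (IsCMField.complexConj L))ᵀ = H') (hH'd : IsUnit H'.det)
    {v : HeightOneSpectrum (𝓞 ↥(maximalRealSubfield L))} (w : PlacesOver L v) (hw : IsCMField.complexConj L • w.1 = w.1)
    (hv : Algebra.IsUnramifiedIn (𝓞 L) v.asIdeal) (hH'w : IsUnit (placeForm H' w.1)) (hH'i : hH'w.unit ∈ glInt 3 (w.1.adicCompletion L))
    (γH : (cmDatum L 2 (Matrix.of fun i j : Fin 2 => if i.val + j.val + 1 = 2 then (1 : L) else 0)).Local v ×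
      (cmDatum L 1 (Matrix.of fun i j : Fin 1 => if i.val + j.val + 1 = 1 then (1 : L) else 0)).Local v)
    {d : Fin 3 → (UnitaryGroup.LocalRing L v)ˣ}
    (hι : ((endoEmbLocal L v γH).val : GL (Fin 3) (UnitaryGroup.LocalRing L v)) = glDiagonal 3 (UnitaryGroup.LocalRing L v) d)
    (hreg : ∀ i j, i ≠ j → IsUnit ((d i : UnitaryGroup.LocalRing L v) - d j)) {γ₀ : (cmDatum L 3 H').Local v}
    (h₀ : IsLocalNormPair L H' v γH γ₀) : finKappaAt L v H' γH γ₀ = 1 := by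
  classical
  have hc := IsCMField.complexConj_ne_one L
  haveI : Algebra.IsQuadraticExtension ↥(maximalRealSubfield L) L := IsCMField.isQuadraticExtension L
  have hvs : Subsingleton (PlacesOver L v) := PlacesOver.subsingleton_of_smul_eq (IsCMField.complexConj L) hc w hw
  have ht := endoEmbLocal_mem_torusU_of_endoEmbLocal_eq L v γH hι
  have ha : IsUnit ((((d 0)⁻¹ * d 1 : (UnitaryGroup.LocalRing L v)ˣ) : UnitaryGroup.LocalRing L v) - 1) :=
    (HeisRing.isUnit_coe_inv_mul_sub_one_iff d 0 1).2 (hreg 1 0 (by decide))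
  have hu : IsUnit ((finCharpolyTwo L v γH).eval (finGammaTwo L v γH)) := by
    rw [eval_finCharpolyTwo_eq_of_endoEmbLocal_eq L v γH hι]
    exact HeisRing.isUnit_weylNumerator (conjLocal L (IsCMField.complexConj L) v) (cmLocalForm_eq_over L 3 v) ⟨_, ht⟩ hι.symm ha
  obtain ⟨ψ, T, -, hJT, -, hconjψ, hcomp⟩ := exists_continuousMulEquiv_level_formCongr_of_nonsplit L H' hH' w hw hv hH'w hH'i
  set γ₁ : (cmDatum L 3 H').Local v :=
    ψ.symm (endoEmbLocal L v γH : ↥(unitaryGroupOfForm (conjLocal L (IsCMField.complexConj L) v) (cmLocalForm L 3 v))) with hγ₁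
  have hψ : ψ γ₁ = (endoEmbLocal L v γH : ↥(unitaryGroupOfForm (conjLocal L (IsCMField.complexConj L) v) (cmLocalForm L 3 v))) :=
    ψ.apply_symm_apply _
  have h₁ : IsLocalNormPair L H' v γH γ₁ := by have h := hconjψ γ₁; rw [hψ] at h; exact h.symm
  obtain ⟨y, hy⟩ := isConj_iff.1 (isConj_of_isLocalNormPair_of_isLocalNormPair_of_levi L H' hH' hH'd γH hι hreg h₁ h₀)
  rw [← hy, finKappaAt_conj_right L v H' γH γ₁ y h₁]
  -- the `w`-components: `γ₁,w = T⁻¹ · diag(d_w) · T`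
  have hGw : localGLPiEquiv L 3 v γ₁.val w =
      T⁻¹ * localGLPiEquiv L 3 v ((endoEmbLocal L v γH).val : GL (Fin 3) (UnitaryGroup.LocalRing L v)) w * T := by
    have h := hcomp γ₁; rw [hψ] at h
    change localGLPiEquiv L 3 v ((endoEmbLocal L v γH).val : GL (Fin 3) (UnitaryGroup.LocalRing L v)) w = _ at h
    rw [h]; group
  have htw : ∀ i j, ((localGLPiEquiv L 3 v ((endoEmbLocal L v γH).val : GL (Fin 3) (UnitaryGroup.LocalRing L v)) w :
      GL (Fin 3) (w.1.adicCompletion L)) : Matrix (Fin 3) (Fin 3) (w.1.adicCompletion L)) i j =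
        (Matrix.diagonal fun k => (d k : UnitaryGroup.LocalRing L v) w) i j := by
    intro i j; rw [localGLPiEquiv_apply_apply, hι, coe_glDiagonal, Matrix.diagonal_apply, Matrix.diagonal_apply]; split_ifs <;> rfl
  have hM : ∀ i j, (γ₁.val.val : Matrix (Fin 3) (Fin 3) (UnitaryGroup.LocalRing L v)) i j w =
      (((T⁻¹ : GL (Fin 3) (w.1.adicCompletion L)) : Matrix (Fin 3) (Fin 3) (w.1.adicCompletion L)) *
        (Matrix.diagonal fun k => (d k : UnitaryGroup.LocalRing L v) w) * (T : Matrix (Fin 3) (Fin 3) (w.1.adicCompletion L))) i j := by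
    intro i j; rw [← localGLPiEquiv_apply_apply, hGw, Units.val_mul, Units.val_mul, Matrix.ext htw]
  -- the eigenvector `p′ = T⁻¹ e₂`
  letI : Unique (PlacesOver L v) := @uniqueOfSubsingleton _ hvs w
  obtain ⟨p', hp'w⟩ : ∃ p' : Fin 3 → UnitaryGroup.LocalRing L v,
      ∀ i, p' i w = ((T⁻¹ : GL (Fin 3) (w.1.adicCompletion L)) : Matrix (Fin 3) (Fin 3) (w.1.adicCompletion L)) i 1 :=
    ⟨fun i => (RingEquiv.piUnique fun w' : PlacesOver L v => w'.1.adicCompletion L).symm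
        (((T⁻¹ : GL (Fin 3) (w.1.adicCompletion L)) : Matrix (Fin 3) (Fin 3) (w.1.adicCompletion L)) i 1),
      fun i => (RingEquiv.piUnique fun w' : PlacesOver L v => w'.1.adicCompletion L).apply_symm_apply _⟩
  have hne : p' ≠ 0 := fun h0 => by
    have hcol : ∀ i, ((T⁻¹ : GL (Fin 3) (w.1.adicCompletion L)) : Matrix (Fin 3) (Fin 3) (w.1.adicCompletion L)) i 1 = 0 := fun i => by
      rw [← hp'w i, h0, Pi.zero_apply, Pi.zero_apply]
    have h11 : ((T : Matrix (Fin 3) (Fin 3) (w.1.adicCompletion L)) *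
        ((T⁻¹ : GL (Fin 3) (w.1.adicCompletion L)) : Matrix (Fin 3) (Fin 3) (w.1.adicCompletion L))) 1 1 = 1 := by
      rw [Units.mul_inv, Matrix.one_apply_eq]
    rw [Matrix.mul_apply] at h11; simp only [hcol, mul_zero, Finset.sum_const_zero] at h11; exact zero_ne_one h11
  have hp' : (γ₁.val.val : Matrix (Fin 3) (Fin 3) (UnitaryGroup.LocalRing L v)) *ᵥ p' =
      finGammaTwo L v γH • p' := by
    funext i
    rw [LocalRing.eq_iff_apply_eq (IsCMField.complexConj L) hc w hw, finGammaTwo_eq_of_endoEmbLocal_eq L v γH hι]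
    simp only [Matrix.mulVec, dotProduct, Finset.sum_apply, Pi.mul_apply, Pi.smul_apply, smul_eq_mul, hM, hp'w]
    rw [← Matrix.mul_apply]
    have hTT : (T : Matrix (Fin 3) (Fin 3) (w.1.adicCompletion L)) * ((T⁻¹ : GL (Fin 3) (w.1.adicCompletion L)) :
        Matrix (Fin 3) (Fin 3) (w.1.adicCompletion L)) = 1 := Units.mul_inv T
    rw [Matrix.mul_assoc, hTT, Matrix.mul_one, Matrix.mul_diagonal, mul_comm]
  -- the `H′`-value of `p′` is `(Φ₃)₂₂ = 1`
  have hx : (∑ i : Fin 3, ∑ k : Fin 3, UnitaryGroup.conjLocal L (IsCMField.complexConj L) v (p' i) *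
      ((UnitaryGroup.adelicForm L 3 H').map (UnitaryGroup.adeleToLocal L v)) i k * p' k) = 1 := by
    rw [LocalRing.eq_iff_apply_eq (IsCMField.complexConj L) hc w hw]
    simp only [Finset.sum_apply, Pi.mul_apply, Pi.one_apply, conjLocal_apply_eq_galAdicCompletionMap L v w hw, localGram_apply_apply, hp'w]
    have hΦ : formCongr (galAdicCompletionMap (L := L) (IsCMField.complexConj L) hw) T⁻¹ (placeForm H' w.1) =
        (StdForm.antidiagonal 3).over (w.1.adicCompletion L) := by
      rw [hJT, formCongr_inv_formCongr]
    have h11 := congrArg (fun M : Matrix (Fin 3) (Fin 3) (w.1.adicCompletion L) => M 1 1) hΦ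
    simp only [formCongr, Matrix.mul_apply, Matrix.transpose_apply, Matrix.map_apply, StdForm.over_antidiagonal_apply, Finset.sum_mul] at h11
    rw [Finset.sum_comm]; simpa using h11
  exact finKappaAt_eq_one_of_eigenvector_of_exists L v H' γH γ₁ hvs h₁ hu hp' hne ⟨1, isUnit_one, by rw [hx, map_one, mul_one]⟩

/-! ## §4 HEAD: `Δ‴_v(γ_H, γ₀) = ‖d₀⁻¹d₁ − 1‖` on the Levi stratum -/

/-- **ROGAWSKI'S TRANSFER FACTOR ON THE LEVI (SPLIT-TORUS) STRATUM AT AN UNRAMIFIED NON-SPLIT PLACE: `Δ‴_v(γ_H, γ₀) = ‖d₀⁻¹d₁ − 1‖`.**  At a finite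
place `v` of `L⁺` non-split and unramified in `L`, for `H′` hermitian of good reduction at `w`, `μ` unramified at `w` under the N7 μ-guard `μ|_{𝕀_{L⁺}} = ω_{L∕L⁺}`,
and `γ_H ∈ H_v` with `ι_v(γ_H) = diag(d₀, d₁, d₂) ∈ T(𝒪_v)` REGULAR: at EVERY matching `γ₀ ∈ U(H′)(L⁺_v)` the explicit factor ★ `finExplicitDelta = τ_v · D_v · κ_v`
equals `‖a − 1‖`, `a = d₀⁻¹d₁` (`‖·‖ =` ★ `unitModulusChar (∏_{w∣v} L_w)`): `τ_v = (−1)^{2·log v_w(a − 1)_w} = 1`, `D_v = ‖a − 1‖ · √‖d₀‖ = ‖a − 1‖`, `κ_v = 1`.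
Print: «`Δ_{G∕H}(γ) = τ(γ)D_{G∕H}(γ)`», `D_{G∕H}(γ) = |(1 − γ₂γ₁⁻¹)(1 − γ₂γ₃⁻¹)|^{1∕2}_E`, Prop. 4.9.1 (b) (`E∕F`, `μ`, `ω` unramified). [cite: Rogawski1990, §4.9 p. 55,
Prop. 4.9.1 (b), (4.9.2); §4.3 p. 43; §14.6 p. 242] [cite: TateThesis1967, §2.5] -/
theorem finExplicitDelta_eq_unitModulusChar_of_levi_of_nonsplit (L : Type) [Field L] [NumberField L] [IsCMField L]
    (H' : Matrix (Fin 3) (Fin 3) L) (hH' : (H'.map (IsCMField.complexConj L))ᵀ = H') (hH'd : IsUnit H'.det)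
    {v : HeightOneSpectrum (𝓞 ↥(maximalRealSubfield L))} (w : PlacesOver L v) (hw : IsCMField.complexConj L • w.1 = w.1)
    (hv : Algebra.IsUnramifiedIn (𝓞 L) v.asIdeal) (hH'w : IsUnit (placeForm H' w.1)) (hH'i : hH'w.unit ∈ glInt 3 (w.1.adicCompletion L))
    (μ : HeckeCharacter L) (hμ : μ.IsUnramifiedAt w.1)
    (hμω : ∀ x : ideleGroup ↥(maximalRealSubfield L), μ (AdeleRing.ideleBaseChange ↥(maximalRealSubfield L) L x) = quadraticHeckeCharCM L x)
    (γH : (cmDatum L 2 (Matrix.of fun i j : Fin 2 => if i.val + j.val + 1 = 2 then (1 : L) else 0)).Local v ×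
      (cmDatum L 1 (Matrix.of fun i j : Fin 1 => if i.val + j.val + 1 = 1 then (1 : L) else 0)).Local v)
    {d : Fin 3 → (UnitaryGroup.LocalRing L v)ˣ}
    (hι : ((endoEmbLocal L v γH).val : GL (Fin 3) (UnitaryGroup.LocalRing L v)) = glDiagonal 3 (UnitaryGroup.LocalRing L v) d)
    (hreg : ∀ i j, i ≠ j → IsUnit ((d i : UnitaryGroup.LocalRing L v) - d j))
    (hint : endoEmbLocal L v γH ∈ cmLocalIntegralLevel L 3 (Matrix.of fun i j : Fin 3 => if i.val + j.val + 1 = 3 then (1 : L) else 0) v)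
    (ha : IsUnit ((((d 0)⁻¹ * d 1 : (UnitaryGroup.LocalRing L v)ˣ) : UnitaryGroup.LocalRing L v) - 1))
    {γ₀ : (cmDatum L 3 H').Local v} (h₀ : IsLocalNormPair L H' v γH γ₀) :
    finExplicitDelta L v H' γH μ γ₀ = (((unitModulusChar (UnitaryGroup.LocalRing L v) ha.unit : ℝ≥0) : ℝ) : ℂ) := by
  classical
  have ht := endoEmbLocal_mem_torusU_of_endoEmbLocal_eq L v γH hι
  have hu : IsUnit ((finCharpolyTwo L v γH).eval (finGammaTwo L v γH)) := by
    rw [eval_finCharpolyTwo_eq_of_endoEmbLocal_eq L v γH hι]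
    exact HeisRing.isUnit_weylNumerator (conjLocal L (IsCMField.complexConj L) v) (cmLocalForm_eq_over L 3 v) ⟨_, ht⟩ hι.symm ha
  rw [finExplicitDelta_of_isLocalNormPair L v H' γH μ h₀, finTau_eq_neg_one_zpow_of_nonsplit_of_isUnramifiedIn L v γH w hw μ hμω hv hμ hu,
    finKappaAt_eq_one_of_levi_of_nonsplit L H' hH' hH'd w hw hv hH'w hH'i γH hι hreg h₀,
    log_valued_eval_finCharpolyTwo_eq_two_mul L v γH hι w hw hint ha, (even_two_mul _).neg_one_zpow, one_mul, Int.cast_one, mul_one]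
  unfold finWeylRatio
  rw [eval_finCharpolyTwo_eq_of_endoEmbLocal_eq L v γH hι, sqrt_prod_norm_weylNumerator_cmLocal L v ht hι.symm ha,
    unitModulusChar_eq_one_of_endoEmbLocal_mem L v γH hι hint 0, NNReal.coe_one, Real.sqrt_one, mul_one]

end Literature.NumberTheory.Rogawski1990

end
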